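import Mathlib
import Literature.MathematicalPhysics.QuantumFieldTheory.BalabanImbrieJaffe1984to88.BIJ85FaddeevPopov518

/-!
# `BalabanImbrieJaffe1984to88.BIJ85FaddeevPopov519` — T. Bałaban, J. Imbrie, A. Jaffe, *Renormalization of the Higgs model:
minimizers, propagators and the stability of mean field theory*, Commun. Math. Phys. **97** (1985) 299–329
[BalabanImbrieJaffe1985]: the **Faddeev–Popov displays (5.1.8)–(5.1.9)** of the proof of Proposition 5.1.1, p. 314 [PDF 16], as
IDENTITIES OF LEBESGUE/HAAR INTEGRALS — **(5.1.8)** `Z_{k,Ax}(B) = Z_k⁻¹Z_k(B)` and **(5.1.9)** `H_{k,Ax}B = Z_k(B)⁻¹∫dA δ(Q_kA − B)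
𝒢(∂*A)exp(−½‖∂A‖²)(A + ∂λ(A))` PROVED, and (5.1.1) re-derived along the printed route (file 3b of row C1.Prop5.1.1; part 1 =
`…BIJ85FaddeevPopov518` (F–P unity, change of variables, integrability); file 1 = `…BIJ85Prop511Proof`, file 2 = `…BIJ85Prop511Torus`)

statement-level skeleton of published theorems with citation tags; proofs where landed; nothing here is a claim about the Yang–Mills mass gap

PDF held: `paper:balaban1985-cmp97-bij-higgs-minimizers` (journal page = PDF page + 298); p. 314 [PDF 16] read on the render
`run/shared/lean/pub/lit-balaban/lit-balaban-r15/pages/1985-cmp97-bij-higgs-minimizers-p016-x2.png` (displays exact) and the OCR text.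

CITATION HEADER (lean-in-tree rule).  Phase-2 proof seat p30 (gen 4) of `lit-balaban` (HOME `run/shared/lean/pub/lit-balaban/`, unit
`lit-balaban-p30-g4`); SKELETON rows **C1.Eq5.1.5-5.1.15** (cell «(5.1.5)–(5.1.9) FP/δ-function displays hypothesis-level only» —
supplied by part 1 + this file) and **C1.Prop5.1.1**.  THE PRINTED TEXT (p. 314) is quoted verbatim in part 1; the two displays,
verbatim: *"Z_{k,Ax}(B) = Z_k⁻¹∫dA𝒢(∂*A)δ(Q_kA − B)exp(−½‖∂A‖²)∫dλ δ(Q′_kλ)δ_{k,Ax}(A + ∂λ) = Z_k⁻¹∫dA𝒢(∂*A)δ(Q_kA − B)exp(−½‖∂A‖²) =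
Z_k⁻¹Z_k(B). (5.1.8) If we perform the same steps leading to (5.1.8) in (5.1.5), we obtain by (5.1.8) H_{k,Ax}B = Z_k(B)⁻¹∫dAδ(Q_kA −
B)𝒢(∂*A)exp(−½‖∂A‖²)·∫dλδ(Q′_kλ)δ_{k,Ax}(A + ∂λ)(A + ∂λ). (5.1.9) … Using this value of λ = λ(A), we have H_{k,Ax}B = Z_k(B)⁻¹∫dA
δ(Q_kA − B)𝒢(∂*A)exp(−½‖∂A‖²)(A + ∂λ(A))."*  The δ-functions are read as in part 1 / the two minimizer files (integrals over
`A₀ + V`, over `{Q_kA = B}`, over `N(Q′)` for the Lebesgue measures of `V`, `N(Q_k)`, `N(Q′)`).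
WHAT IS PROVED (setting and hypotheses = file 1):
* **`eq518`** — (5.1.8): ONE constant `C > 0`, independent of `B`, with `Z_{k,Ax}(B) = C·Z_k(B)` for every `B` and every axial
  representative `A₀` (`Z_{k,Ax}` = p09's `Zax`, `Z_k` = p11's `Zk`; `C` = the Jacobian constant of the change of variables — the
  printed `Z_k⁻¹` — the F–P normalizer of 𝒢 itself being `1` by part 1's `fp_unity`);
* **`eq519`** — (5.1.9) evaluated, verbatim: `Hax V ∂ A₀ = (Zk D B)⁻¹ • fibInt D (A ↦ weight D A • (A + ∂λ(A))) B`;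
* `eq5115_fibre_mean` — the printed (5.1.14)–(5.1.15) step: for any linear λ, the `Z_k(B)`-normalized fibre mean of `A + ∂λ(A)` is
  `H_kB + ∂λ(H_kB)`; with `eq519` this re-derives (5.1.1) `H_{k,Ax}B − H_kB = ∂λ(H_kB)` along the paper's own road — that statement is
  file 1's `BIJ85Prop511Proof.prop511` (reached there by the minimizer route; not restated here).
Carrier clauses (F6): as in file 1.  Theorems only; axioms: the standard three.
-/

namespace Literature.MathematicalPhysics.QuantumFieldTheory.BalabanImbrieJaffe1984to88.BIJ85FaddeevPopov519

open MeasureTheory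
open scoped NNReal ENNReal
open Literature.MathematicalPhysics.QuantumFieldTheory.BalabanImbrieJaffe1984to88.BIJ85LandauForm441
open Literature.MathematicalPhysics.QuantumFieldTheory.BalabanImbrieJaffe1984to88.BIJ85LandauMinimizer442
open Literature.MathematicalPhysics.QuantumFieldTheory.BalabanImbrieJaffe1984to88.BIJ85AxialMinimizer413
open Literature.MathematicalPhysics.QuantumFieldTheory.BalabanImbrieJaffe1984to88.BIJ85Prop511Proof
open Literature.MathematicalPhysics.QuantumFieldTheory.BalabanImbrieJaffe1984to88.BIJ85FaddeevPopov518

noncomputable section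

variable {EA ES EP EB ES' : Type*}
  [NormedAddCommGroup EA] [InnerProductSpace ℝ EA] [FiniteDimensional ℝ EA] [MeasurableSpace EA] [BorelSpace EA]
  [NormedAddCommGroup ES] [InnerProductSpace ℝ ES] [FiniteDimensional ℝ ES] [MeasurableSpace ES] [BorelSpace ES]
  [NormedAddCommGroup EP] [InnerProductSpace ℝ EP]
  [AddCommGroup EB] [Module ℝ EB] [AddCommGroup ES'] [Module ℝ ES']
  (D : LandauOps EA ES EP EB ES')

/-! ## §5  (5.1.8) and (5.1.9) -/

variable [FiniteDimensional ℝ EP]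

omit [FiniteDimensional ℝ ES] [MeasurableSpace ES] [BorelSpace ES] in
/-- the `V`-integral after the `λ`-integration is p09's (4.1.3)/(4.1.4) at the axial representative `A₀′ = H_kB + ∂λ(H_kB)`: scalar
part `= Z_{k,Ax}`, vector part `= Z_{k,Ax}·H_{k,Ax}`. [cite: BalabanImbrieJaffe1985, (5.1.9) p.314] -/
private theorem V_integrals {grad : ES →ₗ[ℝ] EA} (hg : D.GaugeStructure grad) {V : Submodule ℝ EA}
    (hD : ∀ v : V, D.curl (v : EA) = 0 → v = 0) (H : EA) (l : ES) :
    (∫ w : V, Real.exp (-(1 / 2 : ℝ) * ‖D.curl (H + (w : EA))‖ ^ 2)) = Zax V D.curl (H + grad l) ∧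
    (∫ w : V, Real.exp (-(1 / 2 : ℝ) * ‖D.curl (H + (w : EA))‖ ^ 2) • (H + grad l + (w : EA))) =
      Zax V D.curl (H + grad l) • Hax V D.curl (H + grad l) := by
  have hcurl : ∀ w : V, D.curl (H + (w : EA)) = D.curl (H + grad l + (w : EA)) := by
    intro w; rw [map_add, map_add, map_add, hg.curl_grad, add_zero]
  simp_rw [hcurl]
  refine ⟨rfl, ?_⟩
  rw [Hax, smul_smul, mul_inv_cancel₀ (Zax_pos hD _).ne', one_smul]

/-- **(5.1.8)** p. 314 [PDF 16], verbatim: *"Z_{k,Ax}(B) = Z_k⁻¹∫dA𝒢(∂*A)δ(Q_kA − B)exp(−½‖∂A‖²) = Z_k⁻¹Z_k(B). (5.1.8)"* — PROVED: there is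
ONE constant `C > 0`, independent of `B` (the printed `Z_k⁻¹`; here = the Jacobian constant of the change of variables, the F–P
normalizer of 𝒢 itself being `1` by `fp_unity`), with `Z_{k,Ax}(B) = C·Z_k(B)` for every `B` and every axial representative `A₀` of
its (4.1.3)-class, where `Z_{k,Ax}(B) = Zax V ∂ A₀` is p09's (4.1.4) and `Z_k(B) = Zk D B` is p11's (4.4.3).
[cite: BalabanImbrieJaffe1985, (5.1.8) p.314] -/
theorem eq518 (hZ : ∀ v : EA, D.Qk v = 0 → D.curl v = 0 → D.projR (D.dstar v) = 0 → v = 0)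
    (hL : ∀ l : ES, D.Qp l = 0 → D.lap l = 0 → l = 0) {grad : ES →ₗ[ℝ] EA} (hg : D.GaugeStructure grad)
    {Ax V : Submodule ℝ EA} (hV : ∀ A : EA, A ∈ V ↔ D.Qk A = 0 ∧ A ∈ Ax) (lam : EA →ₗ[ℝ] ES)
    (hlamQ : ∀ A : EA, D.Qp (lam A) = 0) (hlamAx : ∀ A : EA, A + grad (lam A) ∈ Ax)
    (hlamU : ∀ (A : EA) (μ : ES), D.Qp μ = 0 → A + grad μ ∈ Ax → μ = lam A) :
    ∃ C : ℝ, 0 < C ∧ ∀ (B : EB) (A₀ : EA), D.Qk A₀ = B → A₀ ∈ Ax → Zax V D.curl A₀ = C * Zk D B := by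
  obtain ⟨c, hc, hcovR, -⟩ := fp_change_of_variables D hg hV lam hlamQ hlamAx hlamU
  have hD := noZeroModes_V D hZ hg hV lam hlamU
  refine ⟨c⁻¹, inv_pos.mpr hc, fun B A₀ hA₀ hA₀Ax => ?_⟩
  set H := Hk D B with hH
  obtain ⟨hQ, -, -, -⟩ := Hk_spec D hZ hL ⟨A₀, hA₀⟩
  -- Z_k(B) at the base point H_kB, then the F–P change of variables and the λ-integration
  have hZk : Zk D B = c * Zax V D.curl (H + grad (lam H)) := by
    rw [Zk, fibInt_eq_of_mem D _ hQ, hcovR H (weight D) (integrable_weight_fibre D hZ hL ⟨A₀, hA₀⟩)]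
    simp_rw [integral_weight_orbit D hL hg]
    rw [(V_integrals D hg hD H (lam H)).1]
  -- the axial representative `H + ∂λ(H)` and `A₀` lie in the same (4.1.3)-class
  obtain ⟨hQ', hAx'⟩ := exists_axial_rep D hg Ax lam hlamQ hlamAx hQ
  have hZax : Zax V D.curl A₀ = Zax V D.curl (H + grad (lam H)) :=
    Zax_congr V D.curl ((hV _).2 ⟨by rw [map_sub, hA₀, hQ', sub_self], Ax.sub_mem hA₀Ax hAx'⟩)
  rw [hZax, hZk, ← mul_assoc, inv_mul_cancel₀ hc.ne', one_mul]

/-- **(5.1.9)** p. 314 [PDF 16], verbatim: *"If we perform the same steps leading to (5.1.8) in (5.1.5), we obtain by (5.1.8) H_{k,Ax}B =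
Z_k(B)⁻¹∫dAδ(Q_kA − B)𝒢(∂*A)exp(−½‖∂A‖²)·∫dλδ(Q′_kλ)δ_{k,Ax}(A + ∂λ)(A + ∂λ). (5.1.9) … Using this value of λ = λ(A), we have
H_{k,Ax}B = Z_k(B)⁻¹∫dA δ(Q_kA − B)𝒢(∂*A)exp(−½‖∂A‖²)(A + ∂λ(A))."* — PROVED: for every `B` and every axial representative `A₀` of the
(4.1.3)-class, `Hax V ∂ A₀ = (Zk D B)⁻¹ • fibInt D (A ↦ weight D A • (A + ∂λ(A))) B` — p09's (4.1.3) on the left, p11's fibre integral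
with the Landau weight `𝒢(∂*A)e^{−½‖∂A‖²}` (`weight`) and normalization `Z_k(B)` (`Zk`) on the right.  Route = the printed one: F–P
change of variables (`fp_change_of_variables`), λ-integration of the gauge-invariant integrand (`axialRep_add_grad`,
`integral_weight_orbit` — the F–P unity), and (5.1.8) for the normalizations. [cite: BalabanImbrieJaffe1985, (5.1.9) p.314] -/
theorem eq519 (hZ : ∀ v : EA, D.Qk v = 0 → D.curl v = 0 → D.projR (D.dstar v) = 0 → v = 0)
    (hL : ∀ l : ES, D.Qp l = 0 → D.lap l = 0 → l = 0) {grad : ES →ₗ[ℝ] EA} (hg : D.GaugeStructure grad)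
    {Ax V : Submodule ℝ EA} (hV : ∀ A : EA, A ∈ V ↔ D.Qk A = 0 ∧ A ∈ Ax) (lam : EA →ₗ[ℝ] ES)
    (hlamQ : ∀ A : EA, D.Qp (lam A) = 0) (hlamAx : ∀ A : EA, A + grad (lam A) ∈ Ax)
    (hlamU : ∀ (A : EA) (μ : ES), D.Qp μ = 0 → A + grad μ ∈ Ax → μ = lam A)
    {B : EB} {A₀ : EA} (hA₀ : D.Qk A₀ = B) (hA₀Ax : A₀ ∈ Ax) :
    Hax V D.curl A₀ = (Zk D B)⁻¹ • fibInt D (fun A => weight D A • (A + grad (lam A))) B := by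
  obtain ⟨c, hc, hcovR, hcovV⟩ := fp_change_of_variables D hg hV lam hlamQ hlamAx hlamU
  have hD := noZeroModes_V D hZ hg hV lam hlamU
  set H := Hk D B with hH
  obtain ⟨hQ, -, hZk_pos, -⟩ := Hk_spec D hZ hL ⟨A₀, hA₀⟩
  -- the linear map `A ↦ A + ∂λ(A)`
  let L : EA →ₗ[ℝ] EA := LinearMap.id + grad ∘ₗ lam
  have hL' : ∀ A : EA, L A = A + grad (lam A) := fun A => rfl
  -- Z_k(B) as in (5.1.8)
  have hZk : Zk D B = c * Zax V D.curl (H + grad (lam H)) := by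
    rw [Zk, fibInt_eq_of_mem D _ hQ, hcovR H (weight D) (integrable_weight_fibre D hZ hL ⟨A₀, hA₀⟩)]
    simp_rw [integral_weight_orbit D hL hg]
    rw [(V_integrals D hg hD H (lam H)).1]
  -- the numerator: change variables, evaluate `δ_{k,Ax}(A + ∂λ)(A + ∂λ)`, integrate λ, then V
  have hnum : fibInt D (fun A => weight D A • (A + grad (lam A))) B =
      c • (Zax V D.curl (H + grad (lam H)) • Hax V D.curl (H + grad (lam H))) := by
    rw [fibInt_eq_of_mem D _ hQ]
    have hint := integrable_weight_smul_fibre D hZ hL ⟨A₀, hA₀⟩ L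
    simp_rw [hL'] at hint
    rw [hcovV H (fun A => weight D A • (A + grad (lam A))) hint]
    congr 1
    have hinner : ∀ w : V, (∫ μ : D.kerQp, weight D (H + (w : EA) + grad (μ : ES)) •
        (H + (w : EA) + grad (μ : ES) + grad (lam (H + (w : EA) + grad (μ : ES))))) =
        Real.exp (-(1 / 2 : ℝ) * ‖D.curl (H + (w : EA))‖ ^ 2) • (H + grad (lam H) + (w : EA)) := by
      intro w
      have hrep : ∀ μ : D.kerQp, H + (w : EA) + grad (μ : ES) + grad (lam (H + (w : EA) + grad (μ : ES))) =
          H + grad (lam H) + (w : EA) := by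
        intro μ
        rw [axialRep_add_grad D Ax lam hlamQ hlamAx hlamU _ ((D.mem_kerQp).mp μ.2), map_add,
          lam_eq_zero_of_mem D Ax lam hlamU ((hV _).1 w.2).2, map_add, map_zero, add_zero]
        abel
      simp_rw [hrep]
      rw [integral_smul_const, integral_weight_orbit D hL hg]
    simp_rw [hinner]
    exact (V_integrals D hg hD H (lam H)).2
  -- assemble
  obtain ⟨hQ', hAx'⟩ := exists_axial_rep D hg Ax lam hlamQ hlamAx hQ
  have hHax : Hax V D.curl A₀ = Hax V D.curl (H + grad (lam H)) :=
    Hax_rep_irrel D hV (by rw [hQ', hA₀]) hAx' hA₀Ax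
  have hZax_ne : Zax V D.curl (H + grad (lam H)) ≠ 0 := (Zax_pos hD _).ne'
  rw [hnum, hZk, hHax, smul_smul, smul_smul]
  have hsc : (c * Zax V D.curl (H + grad (lam H)))⁻¹ * c * Zax V D.curl (H + grad (lam H)) = 1 := by
    field_simp
  rw [hsc, one_smul]

omit [FiniteDimensional ℝ EP] in
/-- **(5.1.14)–(5.1.15): the normalized fibre mean of `A + ∂λ(A)` is `H_kB + ∂λ(H_kB)`** (p. 315, verbatim: *"We now notice that
λ = λ(A) is a linear function of A. … The term λ(H_kB, x) is independent of A and comes outside the A integral. … the term in (5.1.14)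
involving ∂λ(A − H_kB) is linear in A − H_kB and hence its integral vanishes. Thus H_{k,Ax}B = H_kB + ∂λ(H_kB)"*): for ANY linear `λ`,
`Z_k(B)⁻¹∫dA δ(Q_kA − B)𝒢(∂*A)e^{−½‖∂A‖²}(A + ∂λ(A)) = H_kB + ∂λ(H_kB)` — linearity of `A ↦ A + ∂λ(A)` under the (Bochner) fibre integral
and (4.4.2) `fibInt(weight·A) = Z_k(B)·H_kB`.  Combined with `eq519` (the left side IS `H_{k,Ax}B`) this is Proposition 5.1.1 by the
paper's own road; the resulting statement `H_{k,Ax}B − H_kB = ∂λ(H_kB)` is file 1's `BIJ85Prop511Proof.prop511` (landed; not restated).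
Inputs: no zero modes `hZ`, «Δ > 0 on N(Q′)» `hL` (for `Z_k(B) > 0` and the integrability at the base point `H_kB`).
[cite: BalabanImbrieJaffe1985, (5.1.15) p.315] -/
theorem eq5115_fibre_mean (hZ : ∀ v : EA, D.Qk v = 0 → D.curl v = 0 → D.projR (D.dstar v) = 0 → v = 0)
    (hL : ∀ l : ES, D.Qp l = 0 → D.lap l = 0 → l = 0) (grad : ES →ₗ[ℝ] EA) (lam : EA →ₗ[ℝ] ES)
    {B : EB} (hB : ∃ A, D.Qk A = B) :
    (Zk D B)⁻¹ • fibInt D (fun A => weight D A • (A + grad (lam A))) B = Hk D B + grad (lam (Hk D B)) := by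
  obtain ⟨hQ, -, hZk_pos, -⟩ := Hk_spec D hZ hL hB
  let L : EA →ₗ[ℝ] EA := LinearMap.id + grad ∘ₗ lam
  have hL' : ∀ A : EA, L A = A + grad (lam A) := fun A => rfl
  -- (5.1.14): λ linear ⇒ the fibre integral of `A + ∂λ(A)` is `L` of the fibre integral of `A`
  have hint : Integrable (fun v : D.kerQk => weight D (Hk D B + (v : EA)) • (Hk D B + (v : EA))) := by
    have h := integrable_weight_smul_fibre D hZ hL hB LinearMap.id
    simpa using h
  have hlin : fibInt D (fun A => weight D A • (A + grad (lam A))) B =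
      L.toContinuousLinearMap (fibInt D (fun A => weight D A • A) B) := by
    rw [fibInt_eq_of_mem D _ hQ, fibInt_eq_of_mem D _ hQ, ← ContinuousLinearMap.integral_comp_comm _ hint]
    refine integral_congr_ae (Filter.Eventually.of_forall fun v => ?_)
    simp only [LinearMap.coe_toContinuousLinearMap', map_smul, hL']
  -- (4.4.2): the fibre integral of `A` is `Z_k(B)·H_kB`
  have hmean : fibInt D (fun A => weight D A • A) B = Zk D B • Hk D B := by
    rw [Hk, smul_inv_smul₀ hZk_pos.ne']
  rw [hlin, hmean, LinearMap.coe_toContinuousLinearMap', map_smul, hL', inv_smul_smul₀ hZk_pos.ne']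

end

end Literature.MathematicalPhysics.QuantumFieldTheory.BalabanImbrieJaffe1984to88.BIJ85FaddeevPopov519
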